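/-
Copyright: the b2b-balaban cell (near-miss cell 7), T⁴-continuum fan-out, round-2 swarm seat t4-ne7b-formalise-leaf-09
(row S3 of the lineage t4-ne7b-p1's claim table `t4/b2b-balaban-t4-ne7b-p1/LEAVES-NE7b.md`; node U5c COUNT member).
Released under the licence of the surrounding project.
-/
import Summits.QuantumFields.BalabanUV.T4Continuum.Support.HistoryChrono
import Summits.QuantumFields.BalabanUV.T4Continuum.Support.LateMergers

/-!
# History genealogies, part 1: the binary-merger chain along a list

Summits-side support leaf of the T⁴-continuum cell (rung (B)+1 on a FINITE torus only; NOT infinite volume, NOT the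
mass gap, NOT the Clay statement; NOT a proof of the spine estimate NE7b).  Round-2 swarm `t4-ne7b-formalise-*`, row S3
«H2a the genealogy of a live component» of the lineage t4-ne7b-p1's claim table, seat leaf-09; part 1 of
`Support/HistoryGen.lean`.  [folklore] finite bookkeeping over the lineage's OWN carrier `T4PersistenceDictionary.Gen`,
generic in the event type; nothing is quoted from print and nothing printed is asserted; no `[cite:]` tag.

WHY.  Print reduces the second case of its inductive description of the large-field regions («Z is obtained from some
number of components of Z_j, and some number of new large field regions, joined together into the one component of
Z_{j+1}», B16 = [Balaban1989LargeFieldII] p. 386 — CONTEXT, certified C-B16-6 in the cell's records, READ in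
`T4PersistenceDictionary` (L3)) to BINARY steps along a maximal tree, one endpoint at a time.  On the ledger
`T4PersistenceDictionary.Gen` that is a LEFT FOLD of `Gen.merge` over the list of the joined structures: the
accumulated structure (older partner LEFT) absorbs the next endpoint with its own merger event.  This file is that fold
and its bookkeeping, so that the genealogy of a component (`Support/HistoryGen.lean`, part 2) is a recursion over its
pedigree with no list reasoning left to the rows that consume it (S4 consistency, S5 chronology, S6 zones, S7 slots).

WHAT.  §1 `chainMerge G [H₁,…,Hₖ] t = merge (… (merge (merge G H₁ (t 0)) H₂ (t 1)) …) Hₖ (t (k−1))`; root step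
(`rootStep_chainMerge` = the minimum; `rootStep∕root_chainMerge_of_head_le`: OLDER LINE FIRST keeps the head's root step
and root; `exists_root_chainMerge`), reach (`reach_head∕mem_le_chainMerge`), last event (`top_chainMerge`), events
(`mem_events_chainMerge`: a member's event or a merger event), transport along a label map (`gmap_chainMerge`), and the
two structural invariants the rows need: **`staged_chainMerge`** (members `HistoryChrono.Staged st n` and merger events
dated `n` ⇒ the chain is staged at `n` — row S5's chronology) and **`freshT_chainMerge`** (members `LateMergers.FreshT`
with pairwise disjoint events, merger events fresh and pairwise distinct ⇒ the chain is fresh — the label half of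
`Gen.WF`, row S4).  §2 Sanity (decided): a three-member chain.

NOT DONE HERE.  Nothing of Bałaban's; the restriction `TypeNodup ∧ RenewAtReach` of the owner's ruling (LEAVES-NE7b.md
v1.5) concerns the SHAPES of events and enters in part 2 ∕ row S4, not here.  NE7b discharge: no date.

HONEST DEPENDENCY (cell): continuum YM on T⁴ ⇐ BetaPertH ∧ nine spine estimates (0/9 proved); BetaPertH ⇐ (D1) ∧ (D4)
∧ CAP+tail.  This file changes none of it.
-/

open Finset
open Literature.MathematicalPhysics.QuantumFieldTheory.Balaban1983to89
open T4PersistenceDictionary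
open Summit.QuantumFields.BalabanUV.T4Continuum.ZoneSkeleton
open Summit.QuantumFields.BalabanUV.T4Continuum.HistoryChrono
open Summit.QuantumFields.BalabanUV.T4Continuum.LateMergers

namespace Summit.QuantumFields.BalabanUV.T4Continuum.HistoryGen

/-! ## §1 The binary-merger chain along a list -/

section Chain

variable {ε : Type*}

/-- **THE BINARY-MERGER CHAIN**: `chainMerge G [H₁, …, Hₖ] t = merge (… (merge (merge G H₁ (t 0)) H₂ (t 1)) …) Hₖ
(t (k−1))` — a merger of `k + 1` structures at one step written as `k` binary mergers, the accumulated structure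
absorbing ONE further endpoint at a time (print's reduction of the second case to binary steps along a maximal tree,
B16 p. 386, as read in `T4PersistenceDictionary` (L3)); `t i` is the `i`-th merger event. [folklore] -/
def chainMerge : Gen ε → List (Gen ε) → (ℕ → ε) → Gen ε
  | G, [], _ => G
  | G, H :: Hs, t => chainMerge (Gen.merge G H (t 0)) Hs (fun i => t (i + 1))

/-- chain over the empty list [folklore] -/
@[simp] theorem chainMerge_nil (G : Gen ε) (t : ℕ → ε) : chainMerge G [] t = G := rfl

/-- chain over a cons [folklore] -/
@[simp] theorem chainMerge_cons (G H : Gen ε) (Hs : List (Gen ε)) (t : ℕ → ε) :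
    chainMerge G (H :: Hs) t = chainMerge (Gen.merge G H (t 0)) Hs (fun i => t (i + 1)) := rfl

/-- **ROOT STEP OF A CHAIN** = the minimum of the members' root steps. [folklore] -/
theorem rootStep_chainMerge : ∀ (G : Gen ε) (Hs : List (Gen ε)) (t : ℕ → ε),
    (chainMerge G Hs t).rootStep = Hs.foldl (fun m H => min m H.rootStep) G.rootStep
  | _, [], _ => rfl
  | G, H :: Hs, t => by
      rw [chainMerge_cons, rootStep_chainMerge, List.foldl_cons, Gen.rootStep_merge]

/-- the chain is born no later than its head [folklore] -/
theorem rootStep_chainMerge_le_head : ∀ (G : Gen ε) (Hs : List (Gen ε)) (t : ℕ → ε),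
    (chainMerge G Hs t).rootStep ≤ G.rootStep
  | _, [], _ => le_rfl
  | G, H :: Hs, t => by
      rw [chainMerge_cons]
      exact (rootStep_chainMerge_le_head _ Hs _).trans (by rw [Gen.rootStep_merge]; exact min_le_left _ _)

/-- the chain is born no later than any member [folklore] -/
theorem rootStep_chainMerge_le_mem : ∀ (G : Gen ε) (Hs : List (Gen ε)) (t : ℕ → ε),
    ∀ H ∈ Hs, (chainMerge G Hs t).rootStep ≤ H.rootStep
  | _, [], _, H, hH => by simp at hH
  | G, H' :: Hs, t, H, hH => by
      rw [chainMerge_cons]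
      rcases List.mem_cons.1 hH with rfl | hH
      · exact (rootStep_chainMerge_le_head _ Hs _).trans (by rw [Gen.rootStep_merge]; exact min_le_right _ _)
      · exact rootStep_chainMerge_le_mem _ Hs _ H hH

/-- **OLDER LINE FIRST**: if the head is born no later than every member, the chain keeps the head's root step …
[folklore] -/
theorem rootStep_chainMerge_of_head_le : ∀ (G : Gen ε) (Hs : List (Gen ε)) (t : ℕ → ε),
    (∀ H ∈ Hs, G.rootStep ≤ H.rootStep) → (chainMerge G Hs t).rootStep = G.rootStep
  | _, [], _, _ => rfl
  | G, H :: Hs, t, h => by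
      rw [chainMerge_cons]
      have hGH : (Gen.merge G H (t 0)).rootStep = G.rootStep := by
        rw [Gen.rootStep_merge]; exact min_eq_left (h H (List.mem_cons_self))
      rw [rootStep_chainMerge_of_head_le _ Hs _ (fun H' hH' => by rw [hGH]; exact h H' (List.mem_cons_of_mem _ hH')),
        hGH]

/-- … and the head's root (ties in `Gen.root` go to the first partner). [folklore] -/
theorem root_chainMerge_of_head_le : ∀ (G : Gen ε) (Hs : List (Gen ε)) (t : ℕ → ε),
    (∀ H ∈ Hs, G.rootStep ≤ H.rootStep) → (chainMerge G Hs t).root = G.root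
  | _, [], _, _ => rfl
  | G, H :: Hs, t, h => by
      rw [chainMerge_cons]
      have hle : G.rootStep ≤ H.rootStep := h H (List.mem_cons_self)
      have hGH : (Gen.merge G H (t 0)).rootStep = G.rootStep := by
        rw [Gen.rootStep_merge]; exact min_eq_left hle
      rw [root_chainMerge_of_head_le _ Hs _ (fun H' hH' => by rw [hGH]; exact h H' (List.mem_cons_of_mem _ hH'))]
      simp [Gen.root, hle]

/-- the root of a chain is the root of a member of minimal root step [folklore] -/
theorem exists_root_chainMerge : ∀ (G : Gen ε) (Hs : List (Gen ε)) (t : ℕ → ε),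
    ∃ H ∈ G :: Hs, (chainMerge G Hs t).root = H.root ∧ (chainMerge G Hs t).rootStep = H.rootStep
  | G, [], _ => ⟨G, List.mem_cons_self, rfl, rfl⟩
  | G, H :: Hs, t => by
      rw [chainMerge_cons]
      obtain ⟨H', hH', hr, hs⟩ := exists_root_chainMerge (Gen.merge G H (t 0)) Hs (fun i => t (i + 1))
      rcases List.mem_cons.1 hH' with rfl | hH'
      · by_cases hle : G.rootStep ≤ H.rootStep
        · refine ⟨G, List.mem_cons_self, ?_, ?_⟩
          · rw [hr]; simp [Gen.root, hle]
          · rw [hs, Gen.rootStep_merge, min_eq_left hle]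
        · refine ⟨H, List.mem_cons_of_mem _ List.mem_cons_self, ?_, ?_⟩
          · rw [hr]; simp [Gen.root, hle]
          · rw [hs, Gen.rootStep_merge, min_eq_right (not_le.1 hle).le]
      · exact ⟨H', List.mem_cons_of_mem _ (List.mem_cons_of_mem _ hH'), hr, hs⟩

/-- **REACH OF A CHAIN**, one endpoint at a time: absorbing `H` re-opens the merger window beyond the later reach
(`Gen.reach_merge`). [folklore] -/
theorem reach_chainMerge_cons (W : ε → ℕ) (G H : Gen ε) (Hs : List (Gen ε)) (t : ℕ → ε) :
    (chainMerge G (H :: Hs) t).reach W =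
      (chainMerge (Gen.merge G H (t 0)) Hs (fun i => t (i + 1))).reach W := rfl

/-- the reach of a chain is at least the head's reach [folklore] -/
theorem reach_head_le_chainMerge (W : ε → ℕ) : ∀ (G : Gen ε) (Hs : List (Gen ε)) (t : ℕ → ε),
    G.reach W ≤ (chainMerge G Hs t).reach W
  | _, [], _ => le_rfl
  | G, H :: Hs, t => by
      rw [chainMerge_cons]
      refine le_trans ?_ (reach_head_le_chainMerge W _ Hs _)
      rw [Gen.reach_merge]; exact (le_max_left _ _).trans (Nat.le_add_right _ _)

/-- the reach of a chain is at least every member's reach [folklore] -/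
theorem reach_mem_le_chainMerge (W : ε → ℕ) : ∀ (G : Gen ε) (Hs : List (Gen ε)) (t : ℕ → ε),
    ∀ H ∈ Hs, H.reach W ≤ (chainMerge G Hs t).reach W
  | _, [], _, H, hH => by simp at hH
  | G, H' :: Hs, t, H, hH => by
      rw [chainMerge_cons]
      rcases List.mem_cons.1 hH with rfl | hH
      · refine le_trans ?_ (reach_head_le_chainMerge W _ Hs _)
        rw [Gen.reach_merge]; exact (le_max_right _ _).trans (Nat.le_add_right _ _)
      · exact reach_mem_le_chainMerge W _ Hs _ H hH

/-- the last event of a nonempty chain is its last merger event [folklore] -/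
theorem top_chainMerge : ∀ (G : Gen ε) (Hs : List (Gen ε)) (t : ℕ → ε),
    (chainMerge G Hs t).top = if Hs.length = 0 then G.top else t (Hs.length - 1)
  | _, [], _ => rfl
  | G, H :: Hs, t => by
      rw [chainMerge_cons, top_chainMerge _ Hs _]
      cases Hs with
      | nil => simp
      | cons H' Hs' => simp

variable [DecidableEq ε]

/-- **EVENTS OF A CHAIN**: an event of the chain is an event of a member or a merger event. [folklore] -/
theorem mem_events_chainMerge : ∀ {G : Gen ε} {Hs : List (Gen ε)} {t : ℕ → ε} {e : ε},
    e ∈ (chainMerge G Hs t).events ↔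
      e ∈ G.events ∨ (∃ H ∈ Hs, e ∈ H.events) ∨ ∃ i < Hs.length, t i = e
  | _, [], _, _ => by simp
  | G, H :: Hs, t, e => by
      rw [chainMerge_cons, mem_events_chainMerge, Gen.events_merge, mem_insert, mem_union]
      constructor
      · rintro ((rfl | hG | hH) | ⟨H', hH', he⟩ | ⟨i, hi, rfl⟩)
        · exact Or.inr (Or.inr ⟨0, by simp, rfl⟩)
        · exact Or.inl hG
        · exact Or.inr (Or.inl ⟨H, List.mem_cons_self, hH⟩)
        · exact Or.inr (Or.inl ⟨H', List.mem_cons_of_mem _ hH', he⟩)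
        · exact Or.inr (Or.inr ⟨i + 1, by simpa using hi, rfl⟩)
      · rintro (hG | ⟨H', hH', he⟩ | ⟨i, hi, rfl⟩)
        · exact Or.inl (Or.inr (Or.inl hG))
        · rcases List.mem_cons.1 hH' with rfl | hH'
          · exact Or.inl (Or.inr (Or.inr he))
          · exact Or.inr (Or.inl ⟨H', hH', he⟩)
        · cases i with
          | zero => exact Or.inl (Or.inl rfl)
          | succ i => exact Or.inr (Or.inr ⟨i, by simpa using hi, rfl⟩)

/-- the head's events are events of the chain [folklore] -/
theorem events_head_subset_chainMerge (G : Gen ε) (Hs : List (Gen ε)) (t : ℕ → ε) :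
    G.events ⊆ (chainMerge G Hs t).events := fun _ he => mem_events_chainMerge.2 (Or.inl he)

/-- a member's events are events of the chain [folklore] -/
theorem events_mem_subset_chainMerge (G : Gen ε) {Hs : List (Gen ε)} (t : ℕ → ε) {H : Gen ε} (hH : H ∈ Hs) :
    H.events ⊆ (chainMerge G Hs t).events := fun _ he => mem_events_chainMerge.2 (Or.inr (Or.inl ⟨H, hH, he⟩))

/-- the merger events are events of the chain [folklore] -/
theorem tag_mem_events_chainMerge (G : Gen ε) {Hs : List (Gen ε)} (t : ℕ → ε) {i : ℕ} (hi : i < Hs.length) :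
    t i ∈ (chainMerge G Hs t).events := mem_events_chainMerge.2 (Or.inr (Or.inr ⟨i, hi, rfl⟩))

omit [DecidableEq ε] in
/-- **MAPPING A CHAIN** along a map of labels maps the members and the merger events (`ZoneSkeleton.gmap`). [folklore] -/
theorem gmap_chainMerge {δ : Type*} (f : ε → δ) : ∀ (G : Gen ε) (Hs : List (Gen ε)) (t : ℕ → ε),
    gmap f (chainMerge G Hs t) = chainMerge (gmap f G) (Hs.map (gmap f)) (f ∘ t)
  | _, [], _ => rfl
  | G, H :: Hs, t => by
      rw [chainMerge_cons, gmap_chainMerge f _ Hs _, List.map_cons, chainMerge_cons]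
      rfl

/-- **A CHAIN AT ONE STAGE IS STAGED** (`HistoryChrono.Staged`): members staged at `n` joined by merger events dated `n`.
[folklore] -/
theorem staged_chainMerge {st : ε → ℕ} {n : ℕ} : ∀ {G : Gen ε} {Hs : List (Gen ε)} {t : ℕ → ε},
    Staged st n G → (∀ H ∈ Hs, Staged st n H) → (∀ i < Hs.length, st (t i) = n) → Staged st n (chainMerge G Hs t)
  | _, [], _, hG, _, _ => hG
  | G, H :: Hs, t, hG, hHs, ht => by
      rw [chainMerge_cons]
      exact staged_chainMerge (hG.merge_eq (hHs H List.mem_cons_self) (ht 0 (by simp)))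
        (fun H' hH' => hHs H' (List.mem_cons_of_mem _ hH')) fun i hi => ht (i + 1) (by simpa using hi)


/-- **A CHAIN OF FRESH MEMBERS WITH DISJOINT EVENTS AND FRESH, DISTINCT MERGER EVENTS IS FRESH** (`LateMergers.FreshT`,
the label half of `Gen.WF`). [folklore] -/
theorem freshT_chainMerge : ∀ {G : Gen ε} {Hs : List (Gen ε)} {t : ℕ → ε},
    FreshT G → (∀ H ∈ Hs, FreshT H) → (∀ H ∈ Hs, Disjoint G.events H.events) →
      Hs.Pairwise (fun H H' => Disjoint H.events H'.events) →
      (∀ i < Hs.length, t i ∉ G.events ∧ ∀ H ∈ Hs, t i ∉ H.events) →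
      (∀ i j, i < Hs.length → j < Hs.length → t i = t j → i = j) → FreshT (chainMerge G Hs t)
  | _, [], _, hG, _, _, _, _, _ => hG
  | G, H :: Hs, t, hG, hHs, hGd, hpw, ht, hinj => by
      rw [chainMerge_cons]
      rw [List.pairwise_cons] at hpw
      have hlen : ∀ i, i < Hs.length → i + 1 < (H :: Hs).length := fun i hi => by simpa using hi
      have h0 : 0 < (H :: Hs).length := by simp
      refine freshT_chainMerge ?_ (fun H' hH' => hHs H' (List.mem_cons_of_mem _ hH')) ?_ hpw.2 ?_ ?_
      · exact ⟨hG, hHs H List.mem_cons_self, (ht 0 h0).1, (ht 0 h0).2 H List.mem_cons_self,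
          hGd H List.mem_cons_self⟩
      · intro H' hH'
        rw [Gen.events_merge, disjoint_insert_left, disjoint_union_left]
        exact ⟨(ht 0 h0).2 H' (List.mem_cons_of_mem _ hH'), hGd H' (List.mem_cons_of_mem _ hH'), hpw.1 H' hH'⟩
      · intro i hi
        refine ⟨?_, fun H' hH' => (ht (i + 1) (hlen i hi)).2 H' (List.mem_cons_of_mem _ hH')⟩
        rw [Gen.events_merge, mem_insert, mem_union, not_or, not_or]
        refine ⟨fun h => ?_, (ht (i + 1) (hlen i hi)).1, (ht (i + 1) (hlen i hi)).2 H List.mem_cons_self⟩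
        exact absurd (hinj (i + 1) 0 (hlen i hi) h0 h) (Nat.succ_ne_zero i)
      · intro i j hi hj hij
        exact Nat.succ_injective (hinj (i + 1) (j + 1) (hlen i hi) (hlen j hj) hij)

end Chain

/-! ## §2 Sanity (decided) -/

namespace Sanity

/-- three bare regions born at steps `0, 1, 1`, chained at step `2` with merger events `(2,2,0)`, `(2,2,1)` [folklore] -/
def ch : Gen PEv :=
  chainMerge (Gen.born (0, 0, 0) 0) [Gen.born (1, 0, 0) 1, Gen.born (1, 0, 3) 1] fun i => (2, 2, i)

/-- the chain is the left-nested merger [folklore] -/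
example : ch = Gen.merge (Gen.merge (Gen.born (0, 0, 0) 0) (Gen.born (1, 0, 0) 1) (2, 2, 0)) (Gen.born (1, 0, 3) 1)
    (2, 2, 1) := rfl

/-- older line first: root step `0`, root `(0,0,0)`; five events [folklore] -/
example : ch.rootStep = 0 ∧ ch.root = (0, 0, 0) ∧ ch.events.card = 5 := by decide

/-- staged at `2` by `staged_chainMerge` (no unfolding of the fold) [folklore] -/
example : Staged PEv.step 2 ch :=
  staged_chainMerge (staged_born (by decide) _)
    (fun H hH => by
      simp only [List.mem_cons, List.not_mem_nil, or_false] at hH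
      rcases hH with rfl | rfl <;> exact staged_born (by decide) _)
    fun i _ => rfl

end Sanity


end Summit.QuantumFields.BalabanUV.T4Continuum.HistoryGen
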